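import Literature.Barriers.RiemannHypothesis.MollifierLimitations
import HarnessLib

/-!
# Radziwiłł 2012, Theorem 1: the deduction from Proposition A, Lemma 5 and Proposition B

Sibling of `Literature/Barriers/RiemannHypothesis/MollifierLimitations.lean`, which vendors
**Theorem 1** of M. Radziwiłł, *Limitations to mollifying `ζ(s)`* (arXiv:1207.6583) as the named
fact `Literature.Barriers.RiemannHypothesis.Radziwill2012_thm1`:
`𝓘(M_θ) = T⁻¹ ∫_T^{2T} |1 − ζ(½+it) M_θ(½+it)|² dt ≥ c/θ` for an absolute `c > 0`, every `θ > 0`,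
all large `T` and every mollifier `M_θ(s) = ∑_{n ≤ T^θ} a(n) n^{-s}`, `a(1) = 1`, `a(n) ≪ n^ε`.

The printed proof (§4, "Deduction of Theorem 1") assembles Theorem 1 from three inputs, each of
which is far from Mathlib; this file vendors the three inputs as named facts, with the source's own
numbering, and **proves** the deduction (`Radziwill2012_thm1_of_inputs`):

* `Radziwill2012_propA` — **Proposition A** (§1, proved in §3 from a Sobolev-type identity for
  Dirichlet polynomials (Lemma 1), the smooth approximate functional equation of
  Bombieri–Friedlander (Lemma 2), Plancherel (Lemma 3) and the Beurling–Selberg majorant (Lemma 4)):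
  for every `(2πA/log T)`-well-spaced set `S` of zeros of `ζ` on the critical line with ordinates
  in `[T, 2T]`, `𝓘(M_θ) ≥ (1 + O(ε))/(1 + θ + 1/A) · Card S / ((T/2π) log T) + o(1)`.
* `Radziwill2012_lemma5` — **Lemma 5** (§4; Selberg's method, Titchmarsh §10.22): a
  `(2πA/log T)`-well-spaced set of `≫ T log T` zeros of `ζ` on the critical line with ordinates in
  `[T, 2T]`, for an absolute `A > 0`.
* `Radziwill2012_propB` — **Proposition B** (Soundararajan; §1, proved in §7 from the
  Balasubramanian–Conrey–Heath-Brown asymptotic for the twisted second moment): for `θ < 1/2`,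
  `𝓘(M_θ) ≥ 1/θ + o(1)`.
* `Radziwill2012_thm1_of_inputs` — PROVED: the three facts imply `Radziwill2012_thm1`, with
  `c = min (1/2) (π c₀ / (2 (3 + 2/A)))` (`A`, `c₀` the constants of Lemma 5): for `θ ≥ 1/2`
  Proposition A with Lemma 5's set gives `𝓘 ≥ (1−ε)·2πc₀/(1+θ+1/A) − ε ≥ πc₀/(2(3+2/A)θ)`
  (`1 + θ + 1/A ≤ (3 + 2/A)θ` for `θ ≥ 1/2`, `ε = min (1/2) (πc₀/(2(3+2/A)θ))`); for `θ < 1/2`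
  Proposition B with `ε = (1 − c)/θ` gives `𝓘 ≥ c/θ` (§4: "when `θ < 1/2`, Theorem 1 follows from
  Proposition B").

## Reading of the printed statements (design notes)

* "`M_θ` as in (1)" is read exactly as in `Radziwill2012_thm1`: coefficients `a : ℕ → ℂ` with
  `a 1 = 1` and `‖a n‖ ≤ C ε · n^ε` for all `ε > 0`, `n ≥ 1`, for a fixed family of implied constants
  `C : ℝ → ℝ`; "for `T` large" may depend on `θ`, on `C` and on the other fixed parameters
  (`ε`, `A`), never on `a`.
* Proposition A. The printed bound is
  `≥ (1 + O(ε))/(1 + θ + 1/A) · Card(S)/((T/2π) log T) + O(T^ε)`. Read literally, an additive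
  `O(T^ε)` would make the statement empty (`𝓘 ≥ 0` and the main term is `≤ 1/A + o(1)`); the proof
  (§3, last display and the closing paragraph) gives the inequality with the errors
  `O_{η,v}(T^{-v})` and `O(T^η log T)` *before* division by `T`, i.e. an additive `o(1)` after it,
  and §4 uses exactly this ("the liminf of the left-hand side is at least `c/θ`"). We therefore
  render "`(1 + O(ε)) · main + o(1)`, `ε > 0` arbitrary" as: for every `ε > 0`, for `T` large,
  `𝓘 ≥ (1 − ε) · main − ε`. The set `S` is a finite set of ordinates `γ ∈ [T, 2T]` with
  `ζ(½ + iγ) = 0` (the proof evaluates `1 − ζM_θ` at `½ + iγ`; §4 applies it to zeros on the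
  critical line), pairwise `|γ − γ'| ≥ 2πA/log T`; `A > 0` is a free parameter ("`δ := 2πA/log T`").
* Lemma 5 is vendored with its two bullet points as printed; "`≫ T log T`" is an absolute `c₀ > 0`
  and the statement is for all large `T`.
* Proposition B prints `𝓘(M_θ) ∼ Σ_{m,n ≤ T^θ} a(m)ā(n)/[m,n] · (log(T(m,n)²/(2πmn)) + 2 log 2 +
  2γ − 1) − 1 ≥ 1/θ + o(1)` (`θ < 1/2`, `T → ∞`); we vendor the asserted lower bound
  `𝓘(M_θ) ≥ 1/θ + o(1)` (uniform in admissible `a`, as §4 uses it), which is weaker than the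
  printed asymptotic through Soundararajan's quadratic form; the asymptotic itself
  (Balasubramanian–Conrey–Heath-Brown) is recorded here only informally.

## References

* [Radziwill2012] M. Radziwiłł, *Limitations to mollifying ζ(s)*, arXiv:1207.6583 (2012): Thm. 1
  and Prop. B (p. 3), Prop. A (p. 4), §3 (proof of Prop. A, p. 7), §4 (Lemma 5 and the deduction of
  Thm. 1, p. 8), §7 (proof of Prop. B, pp. 12–14).
* [Titchmarsh1986] E. C. Titchmarsh, *The Theory of the Riemann Zeta-Function*, 2nd ed. (1986),
  §10.22, pp. 203–204 (Selberg's `N₀(T) > A T log T` via `m(E) > A₃T`).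
* [Selberg1942] A. Selberg, *On the zeros of Riemann's zeta-function*, Skr. Norske Vid. Akad. Oslo
  I. 10 (1942).
* [BalasubramanianConreyHeathBrown1985] R. Balasubramanian, J. B. Conrey, D. R. Heath-Brown,
  *Asymptotic mean square of the product of the Riemann zeta-function and a Dirichlet polynomial*,
  J. reine angew. Math. 357 (1985), 161–181.
-/

noncomputable section

open Complex MeasureTheory Real

namespace Literature.Barriers.RiemannHypothesis

/-! ## The three inputs, as named facts -/

/-- **Radziwiłł 2012, Proposition A.** "Let `ε > 0` and `θ > 0` be given. Then for `T` large, and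
for `S` any `δ := 2πA/log T` well-spaced subset of zeros of `ζ(s)` with ordinates in `[T; 2T]`, we
have for all `M_θ` as in (1)
`T⁻¹ ∫_T^{2T} |1 − ζ(½+it)M_θ(½+it)|² dt ≥ (1 + O(ε))/(1 + θ + 1/A) · Card(S)/((T/2π) log T) + O(T^ε)`."
Vendored (see the module docstring) with `S` a finite set of ordinates `γ ∈ [T, 2T]` of zeros *on
the critical line*, pairwise `|γ − γ'| ≥ 2πA/log T`, `A > 0` a parameter, and the error terms in
the form the proof (§3) delivers and §4 uses: for every `ε > 0`, for `T ≥ T₀(ε, θ, A, C)`,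
`𝓘(M_θ) ≥ (1 − ε)/(1 + θ + 1/A) · Card(S)/((T/2π) log T) − ε`.
[cite: Radziwill2012, Proposition A] -/
def Radziwill2012_propA : Prop :=
  ∀ ε : ℝ, 0 < ε → ∀ θ : ℝ, 0 < θ → ∀ A : ℝ, 0 < A → ∀ C : ℝ → ℝ,
    ∃ T₀ : ℝ, ∀ T : ℝ, T₀ ≤ T →
      ∀ S : Finset ℝ,
        (∀ γ ∈ S, γ ∈ Set.Icc T (2 * T) ∧ riemannZeta (1 / 2 + γ * I) = 0) →
        (∀ γ ∈ S, ∀ γ' ∈ S, γ ≠ γ' → 2 * π * A / Real.log T ≤ |γ - γ'|) →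
          ∀ a : ℕ → ℂ, a 1 = 1 →
            (∀ ε : ℝ, 0 < ε → ∀ n : ℕ, 1 ≤ n → ‖a n‖ ≤ C ε * (n : ℝ) ^ ε) →
              (1 - ε) / (1 + θ + 1 / A) * ((S.card : ℝ) / (T / (2 * π) * Real.log T)) - ε ≤
                mollificationDefect (dirichletMollifier a ⌊T ^ θ⌋₊) T

/-- **Radziwiłł 2012, Lemma 5** (from Selberg's method, Titchmarsh §10.22). "There is a set `S` of
zeros of `ζ(s)` with `β = ½` and `T ≤ γ ≤ 2T`, such that (i) the elements of `S` are
`2πA/log T` well-spaced, for some absolute constant `A > 0`; (ii) the set `S` has `≫ T log T`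
elements." Vendored for all large `T`, with `S` a finite set of ordinates `γ ∈ [T, 2T]`,
`ζ(½ + iγ) = 0`, pairwise `|γ − γ'| ≥ 2πA/log T`, and `Card S ≥ c₀ T log T` for absolute
`A, c₀ > 0`. [cite: Radziwill2012, Lemma 5] [cite: Titchmarsh1986, §10.22] -/
def Radziwill2012_lemma5 : Prop :=
  ∃ A : ℝ, 0 < A ∧ ∃ c₀ : ℝ, 0 < c₀ ∧ ∃ T₀ : ℝ, ∀ T : ℝ, T₀ ≤ T →
    ∃ S : Finset ℝ,
      (∀ γ ∈ S, γ ∈ Set.Icc T (2 * T) ∧ riemannZeta (1 / 2 + γ * I) = 0) ∧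
      (∀ γ ∈ S, ∀ γ' ∈ S, γ ≠ γ' → 2 * π * A / Real.log T ≤ |γ - γ'|) ∧
      c₀ * T * Real.log T ≤ (S.card : ℝ)

/-- **Radziwiłł 2012, Proposition B** (Soundararajan). "Let `M_θ` be as in (1). If `θ < ½`, then,
as `T → ∞`,
`𝓘(M_θ) ∼ Σ_{m,n ≤ T^θ} a(m)ā(n)/[m,n] · (log(T(m,n)²/(2πmn)) + 2 log 2 + 2γ − 1) − 1 ≥ 1/θ + o(1)`."
Vendored: the asserted lower bound `𝓘(M_θ) ≥ 1/θ + o(1)` for `0 < θ < ½`, uniformly over the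
admissible coefficients (for every `ε > 0` and `T ≥ T₀(θ, C, ε)`, `𝓘(M_θ) ≥ 1/θ − ε`); the
asymptotic through the quadratic form (Balasubramanian–Conrey–Heath-Brown, and §7, Lemmas 9–14)
is not vendored here. [cite: Radziwill2012, Proposition B] -/
def Radziwill2012_propB : Prop :=
  ∀ θ : ℝ, 0 < θ → θ < 1 / 2 → ∀ C : ℝ → ℝ, ∀ ε : ℝ, 0 < ε →
    ∃ T₀ : ℝ, ∀ T : ℝ, T₀ ≤ T →
      ∀ a : ℕ → ℂ, a 1 = 1 →
        (∀ ε : ℝ, 0 < ε → ∀ n : ℕ, 1 ≤ n → ‖a n‖ ≤ C ε * (n : ℝ) ^ ε) →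
          1 / θ - ε ≤ mollificationDefect (dirichletMollifier a ⌊T ^ θ⌋₊) T

/-! ## §4: deduction of Theorem 1 -/

/-- The case `θ ≥ 1/2` of the deduction (§4): Proposition A applied to the set of Lemma 5 gives
`𝓘(M_θ) ≥ π c₀ / (2 (3 + 2/A) θ)` for all large `T`, where `A, c₀` are the constants of Lemma 5.
[cite: Radziwill2012, §4] -/
theorem Radziwill2012_thm1_large_theta (hA : Radziwill2012_propA) {A c₀ T₅ : ℝ} (hA0 : 0 < A)
    (hc₀ : 0 < c₀)
    (h5 : ∀ T : ℝ, T₅ ≤ T → ∃ S : Finset ℝ,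
      (∀ γ ∈ S, γ ∈ Set.Icc T (2 * T) ∧ riemannZeta (1 / 2 + γ * I) = 0) ∧
      (∀ γ ∈ S, ∀ γ' ∈ S, γ ≠ γ' → 2 * π * A / Real.log T ≤ |γ - γ'|) ∧
      c₀ * T * Real.log T ≤ (S.card : ℝ))
    {θ : ℝ} (hθ : 1 / 2 ≤ θ) (C : ℝ → ℝ) :
    ∃ T₀ : ℝ, ∀ T : ℝ, T₀ ≤ T → ∀ a : ℕ → ℂ, a 1 = 1 →
      (∀ ε : ℝ, 0 < ε → ∀ n : ℕ, 1 ≤ n → ‖a n‖ ≤ C ε * (n : ℝ) ^ ε) →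
        π * c₀ / (2 * (3 + 2 / A)) / θ ≤ mollificationDefect (dirichletMollifier a ⌊T ^ θ⌋₊) T := by
  have hθ0 : 0 < θ := by linarith
  set K : ℝ := 3 + 2 / A with hK
  have hK0 : 0 < K := by positivity
  -- the `ε` of Proposition A
  set ε : ℝ := min (1 / 2) (π * c₀ / (2 * K * θ)) with hε
  have hε0 : 0 < ε := lt_min (by norm_num) (by positivity)
  have hε1 : ε ≤ 1 / 2 := min_le_left _ _
  have hε2 : ε ≤ π * c₀ / (2 * K * θ) := min_le_right _ _
  obtain ⟨T₀, hT₀⟩ := hA ε hε0 θ hθ0 A hA0 C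
  refine ⟨max (max T₀ T₅) 2, fun T hT a ha1 ha ↦ ?_⟩
  have hT0 : T₀ ≤ T := le_trans (le_trans (le_max_left _ _) (le_max_left _ _)) hT
  have hT5 : T₅ ≤ T := le_trans (le_trans (le_max_right _ _) (le_max_left _ _)) hT
  have hT2 : (2 : ℝ) ≤ T := le_trans (le_max_right _ _) hT
  have hTpos : 0 < T := by linarith
  have hlog : 0 < Real.log T := Real.log_pos (by linarith)
  obtain ⟨S, hS1, hS2, hS3⟩ := h5 T hT5
  have key := hT₀ T hT0 S hS1 hS2 a ha1 ha
  -- lower bound for the main term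
  have hden : 0 < T / (2 * π) * Real.log T := by positivity
  have hmain : 2 * π * c₀ ≤ (S.card : ℝ) / (T / (2 * π) * Real.log T) := by
    rw [le_div_iff₀ hden]
    have : 2 * π * c₀ * (T / (2 * π) * Real.log T) = c₀ * T * Real.log T := by
      field_simp
    linarith
  have hcoef : 0 ≤ (1 - ε) / (1 + θ + 1 / A) := by
    apply div_nonneg <;> [linarith; positivity]
  have h1 : (1 - ε) / (1 + θ + 1 / A) * (2 * π * c₀) ≤
      (1 - ε) / (1 + θ + 1 / A) * ((S.card : ℝ) / (T / (2 * π) * Real.log T)) :=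
    mul_le_mul_of_nonneg_left hmain hcoef
  -- `1 + θ + 1/A ≤ K θ`
  have hKθ : 1 + θ + 1 / A ≤ K * θ := by
    rw [hK]
    have h2θ : 0 ≤ 2 * θ - 1 := by linarith
    have hA' : 0 ≤ 1 + 1 / A := by positivity
    have hid : (3 + 2 / A) * θ - (1 + θ + 1 / A) = (2 * θ - 1) * (1 + 1 / A) := by ring
    nlinarith [mul_nonneg h2θ hA', hid]
  have hKθpos : 0 < K * θ := by positivity
  have h2 : π * c₀ / (K * θ) ≤ (1 - ε) / (1 + θ + 1 / A) * (2 * π * c₀) := by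
    have hhalf : (1 : ℝ) / 2 ≤ 1 - ε := by linarith
    have hpos3 : 0 < 1 + θ + 1 / A := by positivity
    calc π * c₀ / (K * θ) = 1 / 2 / (K * θ) * (2 * π * c₀) := by field_simp
      _ ≤ (1 - ε) / (1 + θ + 1 / A) * (2 * π * c₀) := by
          apply mul_le_mul_of_nonneg_right _ (by positivity)
          calc 1 / 2 / (K * θ) ≤ 1 / 2 / (1 + θ + 1 / A) :=
                div_le_div_of_nonneg_left (by norm_num) hpos3 hKθ
            _ ≤ (1 - ε) / (1 + θ + 1 / A) := div_le_div_of_nonneg_right hhalf hpos3.le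
  have h3 : π * c₀ / (2 * (3 + 2 / A)) / θ = π * c₀ / (K * θ) - π * c₀ / (2 * K * θ) := by
    rw [hK]; field_simp; ring
  rw [h3]
  linarith

/-- **Deduction of Theorem 1** (Radziwiłł 2012, §4): Proposition A, Lemma 5 and Proposition B imply
Theorem 1, with the absolute constant `c = min (1/2) (π c₀ / (2 (3 + 2/A)))` (`A, c₀` from
Lemma 5): for `θ ≥ 1/2` by `Radziwill2012_thm1_large_theta`, for `θ < 1/2` by Proposition B with
`ε = (1 − c)/θ`. [cite: Radziwill2012, §4] -/
theorem Radziwill2012_thm1_of_inputs (hA : Radziwill2012_propA) (h5 : Radziwill2012_lemma5)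
    (hB : Radziwill2012_propB) : Radziwill2012_thm1 := by
  obtain ⟨A, hA0, c₀, hc₀, T₅, h5⟩ := h5
  set c₂ : ℝ := π * c₀ / (2 * (3 + 2 / A)) with hc₂
  have hc₂0 : 0 < c₂ := by positivity
  set c : ℝ := min (1 / 2) c₂ with hc
  have hc0 : 0 < c := lt_min (by norm_num) hc₂0
  have hc1 : c ≤ 1 / 2 := min_le_left _ _
  have hcc₂ : c ≤ c₂ := min_le_right _ _
  refine ⟨c, hc0, fun θ hθ C ↦ ?_⟩
  rcases lt_or_ge θ (1 / 2) with hθs | hθl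
  · -- `θ < 1/2`: Proposition B with `ε = (1 - c)/θ`
    have hε : 0 < (1 - c) / θ := div_pos (by linarith) hθ
    obtain ⟨T₀, hT₀⟩ := hB θ hθ hθs C ((1 - c) / θ) hε
    refine ⟨T₀, fun T hT a ha1 ha ↦ ?_⟩
    have key := hT₀ T hT a ha1 ha
    have : c / θ = 1 / θ - (1 - c) / θ := by rw [← sub_div]; ring
    linarith
  · -- `θ ≥ 1/2`: Proposition A and Lemma 5
    obtain ⟨T₀, hT₀⟩ := Radziwill2012_thm1_large_theta hA hA0 hc₀ h5 hθl C
    refine ⟨T₀, fun T hT a ha1 ha ↦ ?_⟩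
    have key := hT₀ T hT a ha1 ha
    have : c / θ ≤ c₂ / θ := div_le_div_of_nonneg_right hcc₂ hθ.le
    linarith

/-! ## Scope of Theorem 1 (D-0021 barrier audit of `MollifierLimitationsProofs`, 2026-08-14)

Outcome of the refuter's audit of this file and of the half of the barrier `MollifierLimitations`
that it serves. **Formal content CONFIRMED**: the three vendored inputs are faithful to the printed
paper at the page level and are true theorems as vendored (Proposition A for critical-line zeros is
exactly what §3 proves — "take `u = γ`, with `γ` the ordinate of a zero of `ζ(s)` lying on the
half-line", p. 7; Lemma 5 is Selberg's theorem, p. 8; Proposition B's lower bound is uniform in the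
coefficients because §7 uses only `a(1) = 1`, p. 12, and the Balasubramanian–Conrey–Heath-Brown error
term depends only on the `n^ε`-constants); nothing here is refutable. Two remarks are PROVED below:

* `Radziwill2012_floor_of_propA_lemma5` — Proposition A and Lemma 5 **alone** give an absolute
  `c > 0` with `𝓘(M_θ) ≥ c/(1 + θ)` for *every* `θ > 0`: the qualitative content of the barrier
  (the defect cannot tend to `0` at bounded length) rests on Selberg 1942 and §3 only; Proposition B
  (the unpublished manuscript's §7 and [BalasubramanianConreyHeathBrown1985]) is needed only for
  the rate `1/θ` as `θ → 0`.
* `Radziwill2012_thm1.levinsonMollifier_floor` — Theorem 1 covers the Levinson–Conrey mollifier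
  `M_N`, `N = ⌊T^θ⌋`, of the Bettin–Gonek half of the barrier (`levinsonMollifier`, via the
  admissible coefficients `levinsonCoeff`): `𝓘(M_{⌊T^θ⌋}) ≥ c/θ`.

**Technique coverage NARROWED** (prose of the `BARRIER` block of `MollifierLimitations.lean`; the
Prop `MollifierLimitations` itself is unaffected). What Theorem 1 bounds is the **L²-defect of
`ζ · M` on `σ = ½`** for a one-piece Dirichlet polynomial `M` normalised by `a(1) = 1`. It is not a
theorem about Levinson's method:

1. Radziwiłł defers exactly this: "In a subsequent paper […] we will investigate limitations to
   mollifying `ζ(s)` in the context of Levinson's method" [Radziwill2012, p. 4]; no sequel exists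
   (searched 2026-08-14). The transfer to `κ` is the unproved sentence "his work implies that
   Levinson's method can give `κ = 1` only if it is used with mollifiers of length `T^θ`, where `θ`
   is arbitrarily large" [BettinGonek2017, §1, p. 3].
2. Levinson's method consumes an **upper bound for the Littlewood integral**
   `∫_{T₁}^{T₂} log |G ψ(u + it)| dt` at `u = ½ − a/log T₂`, with `G = ζ + ζ'/F` (Conrey:
   `Q(−L⁻¹ d/ds) ζ`) — `N ≤ (log T₂/(2πa)) ∫ log|Gψ(u+it)| dt + O(log T₂)` — and passes to the
   mollified second moment only through concavity of `log`,
   `∫ log|Gψ| ≤ ½ (T₂ − T₁) log((T₂ − T₁)⁻¹ ∫ |Gψ|²)` [Titchmarsh1986, §10.28]. An L²-defect floor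
   for `ζM` at `σ = ½` constrains neither the log-mean functional, nor the abscissa `u < ½`, nor the
   perturbed function `G ≠ ζ` ("in Levinson's framework, what one needs to mollify is the whole
   perturbed function `V(s)`", [PrattRoblesZaharescuZeindler2020, p. 7]; "if the mollification is
   'nearly perfect', then it opens the possibility for 100%", ibid. p. 6). Sub-L² control of
   `ζ` on the line exists unconditionally (fractional moments `∫_T^{2T}|ζ(½+it)|^{2k} ≪ T (log T)^{k²}`,
   `0 ≤ k ≤ 2`, [HeapRadziwillSoundararajan2019, Thm. 1]).
3. The freedom in `Q` is real: Levinson's method gives a positive proportion for **every** `θ > 0`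
   once `Q` is optimised [ConreyFarmerKwanLinTurnageButterbaugh2025, §1 and Thm. 1 (p. 6: `κ > 2θ/3` for
   `0 < θ < θ₀`)]; `Q` lies
   outside hypothesis (1) of Theorem 1, as do two-piece mollifiers with a `χ(s + ½ − σ₀) Σ μ₂(h) h^{-s} k^{-(1-s)}`
   piece [PrattRoblesZaharescuZeindler2020, p. 7]; "Theorems 1 and 2 have analogues for
   double-mollifiers" is asserted without proof [Radziwill2012, p. 4].
4. The Bettin–Gonek half needs its moment bound **uniformly for all `2 ≤ N ≤ T^θ`** and only for
   the Möbius family `M_N` (its proof integrates `I_y` over `y ∈ [1, x]`, [BettinGonek2017, §2]);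
   for arbitrary coefficients the twisted-moment asymptotic "fails when `θ > 1`"
   [BettinChandeeRadziwill2017, p. 2], and the present frontier of asymptotics — `θ < 17/33` for
   arbitrary `a(n) ≪ n^ε` [BettinChandeeRadziwill2017, Thm. 1], `6/11` for Feng-type and `4/7` for
   Conrey-type coefficients [PrattRobles2018, §1] — is consistent with Theorem 1 (`𝓘(𝓛_θ) ∼ 1/θ`),
   not an evasion of it.

## Additional references (locators verified with `lit read`)

* [PrattRoblesZaharescuZeindler2020] K. Pratt, N. Robles, A. Zaharescu, D. Zeindler, *More than
  five-twelfths of the zeros of ζ are on the critical line*, Res. Math. Sci. 7 (2020) =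
  arXiv:1802.10521, §1 (pp. 6–7).
* [ConreyFarmerKwanLinTurnageButterbaugh2025] J. B. Conrey, D. W. Farmer, C.-H. Kwan, Y. Lin,
  C. L. Turnage-Butterbaugh, *Short mollifiers of the Riemann zeta-function*, arXiv:2508.11108,
  abstract, §1 (pp. 2–4) and Thm. 1 (§2.1, p. 6).
* [BettinChandeeRadziwill2017] S. Bettin, V. Chandee, M. Radziwiłł, *The mean square of the product
  of the Riemann zeta-function with Dirichlet polynomials*, J. reine angew. Math. 729 (2017) =
  arXiv:1411.7764, §1 (pp. 1–3) and Thm. 1.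
* [PrattRobles2018] K. Pratt, N. Robles, *Perturbed moments and a longer mollifier for critical
  zeros of ζ*, Res. Number Theory 4 (2018) = arXiv:1706.04593, §1.1 (p. 3).
* [HeapRadziwillSoundararajan2019] W. Heap, M. Radziwiłł, K. Soundararajan, *Sharp upper bounds for
  fractional moments of the Riemann zeta function*, Q. J. Math. 70 (2019) = arXiv:1901.08423, Thm. 1.
* [Titchmarsh1986] §10.28 (Levinson's method: Littlewood's formula, the concavity step (10.28.10),
  (10.28.11)).
-/

open scoped ArithmeticFunction.Moebius

/-! ### The floor without Proposition B -/

/-- **The floor at every fixed length, from Proposition A and Lemma 5 alone.** There is an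
absolute `c > 0` (`c = π c₀ A / (2 (A + 1))`, `A, c₀` the constants of Lemma 5) such that for
every `θ > 0`, all large `T` and all admissible coefficients, `𝓘(M_θ) ≥ c/(1 + θ)`: Proposition A
with Lemma 5's set and `ε = min (1/2) (π c₀/(2(1 + θ + 1/A)))` gives
`𝓘 ≥ π c₀/(2(1 + θ + 1/A)) ≥ c/(1 + θ)` since `1 + θ + 1/A ≤ (1 + 1/A)(1 + θ)`. Proposition B is
thus needed only to upgrade the rate to `1/θ` for `θ < 1/2`. [cite: Radziwill2012, §4] -/
theorem Radziwill2012_floor_of_propA_lemma5 (hA : Radziwill2012_propA)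
    (h5 : Radziwill2012_lemma5) :
    ∃ c : ℝ, 0 < c ∧ ∀ θ : ℝ, 0 < θ → ∀ C : ℝ → ℝ, ∃ T₀ : ℝ, ∀ T : ℝ, T₀ ≤ T →
      ∀ a : ℕ → ℂ, a 1 = 1 →
        (∀ ε : ℝ, 0 < ε → ∀ n : ℕ, 1 ≤ n → ‖a n‖ ≤ C ε * (n : ℝ) ^ ε) →
          c / (1 + θ) ≤ mollificationDefect (dirichletMollifier a ⌊T ^ θ⌋₊) T := by
  obtain ⟨A, hA0, c₀, hc₀, T₅, h5⟩ := h5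
  refine ⟨π * c₀ * A / (2 * (A + 1)), by positivity, fun θ hθ C ↦ ?_⟩
  set D : ℝ := 1 + θ + 1 / A with hD
  have hD0 : 0 < D := by positivity
  -- the `ε` of Proposition A
  set ε : ℝ := min (1 / 2) (π * c₀ / (2 * D)) with hε
  have hε0 : 0 < ε := lt_min (by norm_num) (by positivity)
  have hε1 : ε ≤ 1 / 2 := min_le_left _ _
  have hε2 : ε ≤ π * c₀ / (2 * D) := min_le_right _ _
  obtain ⟨T₀, hT₀⟩ := hA ε hε0 θ hθ A hA0 C
  refine ⟨max (max T₀ T₅) 2, fun T hT a ha1 ha ↦ ?_⟩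
  have hT0 : T₀ ≤ T := le_trans (le_trans (le_max_left _ _) (le_max_left _ _)) hT
  have hT5 : T₅ ≤ T := le_trans (le_trans (le_max_right _ _) (le_max_left _ _)) hT
  have hT2 : (2 : ℝ) ≤ T := le_trans (le_max_right _ _) hT
  have hTpos : 0 < T := by linarith
  have hlog : 0 < Real.log T := Real.log_pos (by linarith)
  obtain ⟨S, hS1, hS2, hS3⟩ := h5 T hT5
  have key := hT₀ T hT0 S hS1 hS2 a ha1 ha
  have hden : 0 < T / (2 * π) * Real.log T := by positivity
  have hmain : 2 * π * c₀ ≤ (S.card : ℝ) / (T / (2 * π) * Real.log T) := by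
    rw [le_div_iff₀ hden]
    have : 2 * π * c₀ * (T / (2 * π) * Real.log T) = c₀ * T * Real.log T := by
      field_simp
    linarith
  have hcoef : 0 ≤ (1 - ε) / D := by
    apply div_nonneg <;> [linarith; positivity]
  have h1 : (1 - ε) / D * (2 * π * c₀) ≤
      (1 - ε) / D * ((S.card : ℝ) / (T / (2 * π) * Real.log T)) :=
    mul_le_mul_of_nonneg_left hmain hcoef
  -- `(1 - ε) 2πc₀/D ≥ πc₀/D`
  have h2 : π * c₀ / D ≤ (1 - ε) / D * (2 * π * c₀) := by
    have hhalf : (1 : ℝ) / 2 ≤ 1 - ε := by linarith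
    calc π * c₀ / D = 1 / 2 / D * (2 * π * c₀) := by field_simp
      _ ≤ (1 - ε) / D * (2 * π * c₀) := by
          apply mul_le_mul_of_nonneg_right _ (by positivity)
          exact div_le_div_of_nonneg_right hhalf hD0.le
  -- `D ≤ (1 + 1/A)(1 + θ)`
  have hDle : D ≤ (A + 1) / A * (1 + θ) := by
    rw [hD]
    have hA' : (A + 1) / A * (1 + θ) = 1 + θ + 1 / A + θ / A := by field_simp; ring
    rw [hA']
    have : 0 ≤ θ / A := by positivity
    linarith
  have h3 : π * c₀ * A / (2 * (A + 1)) / (1 + θ) ≤ π * c₀ / (2 * D) := by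
    have hθ1 : 0 < 1 + θ := by linarith
    have hrw : π * c₀ * A / (2 * (A + 1)) / (1 + θ) = π * c₀ / (2 * ((A + 1) / A * (1 + θ))) := by
      field_simp
    rw [hrw]
    exact div_le_div_of_nonneg_left (by positivity) (by positivity) (by linarith)
  have h4 : π * c₀ / (2 * D) = π * c₀ / D - π * c₀ / (2 * D) := by ring
  linarith

/-! ### Theorem 1 covers the Levinson–Conrey mollifier of Bettin–Gonek -/

/-- The Levinson–Conrey coefficients at length `N`, truncated beyond `N`:
`a_N(n) = μ(n) (1 − log n / log N)` for `n ≤ N` and `0` for `n > N`, so that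
`M_N = dirichletMollifier a_N N` (`levinsonMollifier_eq_dirichletMollifier`).
[cite: BettinGonek2017, §1] -/
def levinsonCoeff (N : ℕ) (n : ℕ) : ℂ :=
  if n ≤ N then ((μ n : ℤ) : ℂ) * ((1 - Real.log n / Real.log N : ℝ) : ℂ) else 0

/-- `a_N(1) = μ(1)(1 − 0) = 1` for `N ≥ 1`. [folklore] -/
theorem levinsonCoeff_one {N : ℕ} (hN : 1 ≤ N) : levinsonCoeff N 1 = 1 := by
  simp [levinsonCoeff, hN]

/-- `|a_N(n)| ≤ 1` for `n ≥ 1`: `|μ(n)| ≤ 1` and `0 ≤ log n / log N ≤ 1` for `1 ≤ n ≤ N`.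
[folklore] -/
theorem norm_levinsonCoeff_le (N n : ℕ) (hn : 1 ≤ n) : ‖levinsonCoeff N n‖ ≤ 1 := by
  unfold levinsonCoeff
  split_ifs with h
  · rw [norm_mul]
    have hμ : ‖((μ n : ℤ) : ℂ)‖ ≤ 1 := by
      rw [Complex.norm_intCast]
      exact_mod_cast ArithmeticFunction.abs_moebius_le_one
    have hw : ‖((1 - Real.log n / Real.log N : ℝ) : ℂ)‖ ≤ 1 := by
      rw [Complex.norm_real, Real.norm_eq_abs, abs_le]
      have hn0 : (0 : ℝ) ≤ Real.log n := Real.log_nonneg (by exact_mod_cast hn)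
      have hN0 : (0 : ℝ) ≤ Real.log N := Real.log_nonneg (by exact_mod_cast (le_trans hn h))
      have hle : Real.log n ≤ Real.log N :=
        Real.log_le_log (by exact_mod_cast hn) (by exact_mod_cast h)
      constructor
      · have : Real.log n / Real.log N ≤ 1 := div_le_one_of_le₀ hle hN0
        linarith
      · have : 0 ≤ Real.log n / Real.log N := div_nonneg hn0 hN0
        linarith
    calc ‖((μ n : ℤ) : ℂ)‖ * ‖((1 - Real.log n / Real.log N : ℝ) : ℂ)‖ ≤ 1 * 1 :=
          mul_le_mul hμ hw (norm_nonneg _) (by norm_num)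
      _ = 1 := by norm_num
  · simp

/-- The Levinson–Conrey mollifier is the Dirichlet-polynomial mollifier with coefficients
`levinsonCoeff N`. [cite: BettinGonek2017, §1] [cite: Radziwill2012, (1)] -/
theorem levinsonMollifier_eq_dirichletMollifier (N : ℕ) :
    levinsonMollifier N = dirichletMollifier (levinsonCoeff N) N := by
  funext s
  unfold levinsonMollifier dirichletMollifier
  refine Finset.sum_congr rfl fun n hn ↦ ?_
  have hnN : n ≤ N := (Finset.mem_Icc.1 hn).2
  simp [levinsonCoeff, hnN]

/-- **Theorem 1 covers the mollifier of the θ = ∞ conjecture.** From `Radziwill2012_thm1`: there is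
an absolute `c > 0` such that for every `θ > 0` and all large `T`, the Levinson–Conrey mollifier
`M_N(s) = ∑_{n ≤ N} μ(n) n^{-s} (1 − log n/log N)` of length `N = ⌊T^θ⌋` (the `M_N` of
`BettinGonek2017_thm1`) has `𝓘(M_N) ≥ c/θ` (its coefficients are admissible with `C ≡ 1`).
[cite: Radziwill2012, Theorem 1] [cite: BettinGonek2017, §1] -/
theorem Radziwill2012_thm1.levinsonMollifier_floor (h : Radziwill2012_thm1) :
    ∃ c : ℝ, 0 < c ∧ ∀ θ : ℝ, 0 < θ → ∃ T₀ : ℝ, ∀ T : ℝ, T₀ ≤ T →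
      c / θ ≤ mollificationDefect (levinsonMollifier ⌊T ^ θ⌋₊) T := by
  obtain ⟨c, hc, h⟩ := h
  refine ⟨c, hc, fun θ hθ ↦ ?_⟩
  obtain ⟨T₀, hT₀⟩ := h θ hθ (fun _ ↦ 1)
  refine ⟨max T₀ 1, fun T hT ↦ ?_⟩
  have hT0 : T₀ ≤ T := le_trans (le_max_left _ _) hT
  have hT1 : (1 : ℝ) ≤ T := le_trans (le_max_right _ _) hT
  have hN : 1 ≤ ⌊T ^ θ⌋₊ := Nat.le_floor (by exact_mod_cast Real.one_le_rpow hT1 hθ.le)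
  rw [levinsonMollifier_eq_dirichletMollifier]
  refine hT₀ T hT0 (levinsonCoeff ⌊T ^ θ⌋₊) (levinsonCoeff_one hN) ?_
  intro ε hε n hn
  calc ‖levinsonCoeff ⌊T ^ θ⌋₊ n‖ ≤ 1 := norm_levinsonCoeff_le _ n hn
    _ ≤ 1 * (n : ℝ) ^ ε := by
        rw [one_mul]
        exact Real.one_le_rpow (by exact_mod_cast hn) hε.le

end Literature.Barriers.RiemannHypothesis
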